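/-
Origin: expansion seat `planner-pub-hodgecm-pv02-g3-0`, handover #3 2026-08-18T05:13:24Z (`HOME/pub-hodgecm-pv02-g3/lean/Pv02g3/PerL34/BallCRCurves.lean`, md5 65e8ca89, 177 lines);
landed by the gen-6 packager in gate run 22 as `HodgeCM/PerL34/BallCRCurves.lean` (import ^import Pv[0-9]+g[0-9]+\.PerL34\.→import HodgeCM.PerL34. ×1; stripped 3 #print/#check/#eval lines).
-/
/-
Origin: planner-pub-hodgecm-pv02-g3-0 (unit pub-hodgecm-pv02-g3, DAG-NODE PROVER #02 gen 3), 2026-08-18.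
Proposed tree path: `HodgeCM/PerL34/BallCRCurves.lean` (new, additive; lands AFTER `BallCR` (pv02-g3)).
PACKAGER: `import Pv02g3.PerL34.BallCR` becomes `import HodgeCM.PerL34.BallCR`.  KERNEL: nothing cited, nothing
asserted.
-/
import Summits.HodgeConjecture.HodgeCM.PerL34.BallCR_2

/-!
# The `𝔭₋`-operators of `BallCR` are curve-independent

`BallCR.Xminus v` was DEFINED through the particular curves `t ↦ g·g_{c_v(t)}` (pv03's boosts along
`c_v(t) = t v /(1 + t²|v|²)`), certified to leave `1` with velocity `X_v = ((0,v),(v*,0)) ∈ 𝔭`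
(`BallCR.hasDerivAt_secMat_cv`).  This file proves that on cochains the operator does not depend on that choice:
for ANY curve `γ : ℝ → U(2,1)` with `γ(0) = 1` whose matrix entries have derivative `X_v` at `t = 0`
(`TangentCurve v γ`) and any `u` real-differentiable on the ball,

* `hasDerivAt_Jac_curve` — `t ↦ Jac(γ(t), x₀)` has derivative `0` at `0` (no connection term along `𝔭`);
* `hasDerivAt_smul_x₀_curve` — `t ↦ γ(t)·x₀` has velocity `v`;
* `hasDerivAt_R_curve` — `t ↦ R u (g·γ(t))` has derivative `D(g^*u)(0)·v`, the same as along the boost;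
* `Xminus_apply_of_curves` — for `φ ∈ ballFD.Cochain`,
  `X⁻_v φ (g) = ∂_t φ(g·γ₁(t))|₀ + i ∂_t φ(g·γ₂(t))|₀` for any `γ₁` tangent to `X_v` and `γ₂` tangent to `X_{iv}`.

So `X⁻_v` restricted to cochains IS the right Lie derivative along `X_v + i X_{iv} ∈ 𝔭^{0,1} = 𝔭₋` in the
ordinary sense (any `C¹` representative curve, e.g. `t ↦ exp(t X_v)`), which is the form in which the (X1) side
("`R(𝔭₋)` kills the theta one-forms", a statement about the differentiated right-regular action) meets it.
-/

noncomputable section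

open Complex ComplexConjugate
open scoped Matrix

namespace HodgeCM
namespace PerL34
namespace BallCR

open HodgeCM.PerL34.BallModel HodgeCM.PerL34.BallSpans HodgeCM.PerL34.BallFrame

/-- A curve in `U(2,1)` through `1` at `t = 0` whose matrix entries have derivative `X_v` there. -/
structure TangentCurve (v : Fin 2 → ℂ) (γ : ℝ → U21) : Prop where
  zero : γ 0 = 1
  hasDerivAt : ∀ i j, HasDerivAt (fun t : ℝ => mat (γ t) i j) (Xp v i j) 0

/-- (Ported verbatim from the HodgeCMPerL package; no docstring in the source.) -/
theorem sec_cv_zero (v : Fin 2 → ℂ) : sec (cv v 0) = 1 := by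
  apply Subtype.ext; apply Units.ext
  change secMat (cv v 0) = ((1 : U21) : GL3).1
  rw [secMat_cv_zero]; simp

/-- The boosts of `BallCR` are tangent curves. -/
theorem tangentCurve_boost (v : Fin 2 → ℂ) : TangentCurve v (fun t => sec (cv v t)) :=
  ⟨sec_cv_zero v, fun i j => by simpa using hasDerivAt_secMat_cv v i j⟩

namespace TangentCurve

variable {v : Fin 2 → ℂ} {γ : ℝ → U21} (h : TangentCurve v γ)
include h

/-- (Ported verbatim from the HodgeCMPerL package; no docstring in the source.) -/
theorem mat_zero : mat (γ 0) = 1 := by rw [h.zero, mat_one]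

/-- (Ported verbatim from the HodgeCMPerL package; no docstring in the source.) -/
theorem mat_zero_apply (i j : Fin 3) : mat (γ 0) i j = if i = j then 1 else 0 := by
  rw [h.mat_zero, Matrix.one_apply]

/-- The corner entry `γ(t)₂₂` has derivative `0` (`(X_v)₂₂ = 0`) and value `1`. -/
theorem hasDerivAt_corner : HasDerivAt (fun t : ℝ => mat (γ t) 2 2) 0 0 := by
  simpa [Xp] using h.hasDerivAt 2 2

/-- The `K`-block entries have derivative `0` (`X_v ∈ 𝔭`). -/
theorem hasDerivAt_block (i j : Fin 2) :
    HasDerivAt (fun t : ℝ => mat (γ t) (Fin.castSucc i) (Fin.castSucc j)) 0 0 := by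
  have := h.hasDerivAt (Fin.castSucc i) (Fin.castSucc j)
  fin_cases i <;> fin_cases j <;> simpa [Xp] using this

/-- The last column has derivative `v`. -/
theorem hasDerivAt_col (i : Fin 2) : HasDerivAt (fun t : ℝ => mat (γ t) (Fin.castSucc i) 2) (v i) 0 := by
  have := h.hasDerivAt (Fin.castSucc i) 2
  fin_cases i <;> simpa [Xp] using this

/-- **`t ↦ γ(t)·x₀` has velocity `v`.** -/
theorem hasDerivAt_smul_x₀ : HasDerivAt (fun t : ℝ => ((γ t) • x₀).1) v 0 := by
  rw [hasDerivAt_pi]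
  intro i
  have hfun : (fun t : ℝ => ((γ t) • x₀).1 i) = fun t => mat (γ t) (Fin.castSucc i) 2 / mat (γ t) 2 2 := by
    funext t; rw [smul_val, W3_apply, W3_apply]; simp
  rw [hfun]
  have hd := (h.hasDerivAt_col i).fun_div h.hasDerivAt_corner (by rw [h.mat_zero_apply]; simp)
  refine hd.congr_deriv ?_
  rw [h.mat_zero_apply, h.mat_zero_apply]
  fin_cases i <;> simp

/-- **No connection term along `𝔭`**: `t ↦ Jac(γ(t), x₀)_{ij}` has derivative `0` at `t = 0`. -/
theorem hasDerivAt_Jac (i j : Fin 2) : HasDerivAt (fun t : ℝ => Jac (γ t) x₀ i j) 0 0 := by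
  have hfun : (fun t : ℝ => Jac (γ t) x₀ i j) = fun t =>
      (mat (γ t) (Fin.castSucc i) (Fin.castSucc j) * mat (γ t) 2 2 -
        mat (γ t) (Fin.castSucc i) 2 * mat (γ t) 2 (Fin.castSucc j)) / mat (γ t) 2 2 ^ 2 := by
    funext t; simp [Jac, W3_apply]
  rw [hfun]
  have hrow : HasDerivAt (fun t : ℝ => mat (γ t) 2 (Fin.castSucc j)) (conj (v j)) 0 := by
    have := h.hasDerivAt 2 (Fin.castSucc j)
    fin_cases j <;> simpa [Xp] using this
  have hnum := ((h.hasDerivAt_block i j).fun_mul h.hasDerivAt_corner).fun_sub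
    ((h.hasDerivAt_col i).fun_mul hrow)
  have hden := h.hasDerivAt_corner.fun_pow 2
  have hd := hnum.fun_div hden (by rw [h.mat_zero_apply]; simp)
  refine hd.congr_deriv ?_
  simp only [h.mat_zero_apply]
  fin_cases i <;> fin_cases j <;> simp

end TangentCurve

/-- `R u (g·γ(t)) = ᵗJac(γ(t), x₀) · (g^*u)(γ(t)·x₀)`. -/
theorem R_curve (u : Ball → (Fin 2 → ℂ)) (g : U21) (γ : ℝ → U21) (t : ℝ) :
    R u (g * γ t) = (Jac (γ t) x₀)ᵀ *ᵥ pullVec g u ((γ t) • x₀).1 := by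
  rw [R_mul, pullVec_val]

/-- (Ported verbatim from the HodgeCMPerL package; no docstring in the source.) -/
theorem R_curve_apply (u : Ball → (Fin 2 → ℂ)) (g : U21) (γ : ℝ → U21) (t : ℝ) (i : Fin 2) :
    R u (g * γ t) i =
      Jac (γ t) x₀ 0 i * pullVec g u ((γ t) • x₀).1 0 + Jac (γ t) x₀ 1 i * pullVec g u ((γ t) • x₀).1 1 := by
  rw [R_curve]; simp [Matrix.mulVec, dotProduct, Fin.sum_univ_two, Matrix.transpose_apply]

/-- **The right derivative of a frame function along ANY curve tangent to `X_v` is `D(g^*u)(0)·v`.** -/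
theorem hasDerivAt_R_curve {u : Ball → (Fin 2 → ℂ)} {g : U21} {P : (Fin 2 → ℂ) →L[ℝ] (Fin 2 → ℂ)}
    (hP : HasFDerivAt (pullVec g u) P 0) {v : Fin 2 → ℂ} {γ : ℝ → U21} (h : TangentCurve v γ) :
    HasDerivAt (fun t : ℝ => R u (g * γ t)) (P v) 0 := by
  have hc : HasDerivAt (fun t : ℝ => ((γ t) • x₀).1) v 0 := h.hasDerivAt_smul_x₀
  have h0 : ((γ 0) • x₀).1 = 0 := by rw [h.zero, one_smul, x₀_val]
  have hP' : HasFDerivAt (pullVec g u) P ((fun t : ℝ => ((γ t) • x₀).1) 0) := by simpa [h0] using hP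
  have hcomp : HasDerivAt (pullVec g u ∘ fun t : ℝ => ((γ t) • x₀).1) (P v) 0 :=
    HasFDerivAt.comp_hasDerivAt (0 : ℝ) hP' hc
  have hcoord : ∀ j : Fin 2, HasDerivAt (fun t : ℝ => pullVec g u ((γ t) • x₀).1 j) (P v j) 0 := fun j =>
    hasDerivAt_pi.1 hcomp j
  have hJ0 : ∀ i j : Fin 2, Jac (γ 0) x₀ i j = if i = j then 1 else 0 := fun i j => by
    rw [h.zero, Jac_one, Matrix.one_apply]
  rw [hasDerivAt_pi]
  intro i
  have hfun : (fun t : ℝ => R u (g * γ t) i) = fun t =>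
      Jac (γ t) x₀ 0 i * pullVec g u ((γ t) • x₀).1 0 + Jac (γ t) x₀ 1 i * pullVec g u ((γ t) • x₀).1 1 :=
    funext fun t => R_curve_apply u g γ t i
  rw [hfun]
  have hd := ((h.hasDerivAt_Jac 0 i).fun_mul (hcoord 0)).fun_add ((h.hasDerivAt_Jac 1 i).fun_mul (hcoord 1))
  refine hd.congr_deriv ?_
  fin_cases i <;> simp [hJ0]

/-- The curve derivative of `R u` along a tangent curve equals the one along the boost (`BallCR.pDer_R`). -/
theorem deriv_R_curve {u : Ball → (Fin 2 → ℂ)} (hu : ballC1 u) (g : U21) {v : Fin 2 → ℂ} {γ : ℝ → U21}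
    (h : TangentCurve v γ) : deriv (fun t : ℝ => R u (g * γ t)) 0 = fderiv ℝ (pullVec g u) 0 v := by
  have hd : DifferentiableAt ℝ (pullVec g u) 0 := differentiableAt_pullVec (by rw [actVec_zero_eq]; exact hu _)
  exact (hasDerivAt_R_curve hd.hasFDerivAt h).deriv

/-- **`X⁻_v` on cochains is the Lie derivative along `X_v + i X_{iv}` computed with ANY tangent curves.** -/
theorem Xminus_apply_of_curves {φ : U21 → (Fin 2 → ℂ)} (hφ : φ ∈ ballFD.Cochain) {v : Fin 2 → ℂ}
    {γ₁ γ₂ : ℝ → U21} (h₁ : TangentCurve v γ₁) (h₂ : TangentCurve (I • v) γ₂) (g : U21) :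
    Xminus v φ g = deriv (fun t : ℝ => φ (g * γ₁ t)) 0 + I • deriv (fun t : ℝ => φ (g * γ₂ t)) 0 := by
  obtain ⟨u, hu, rfl⟩ := hφ
  rw [Xminus_R hu, deriv_R_curve hu g h₁, deriv_R_curve hu g h₂]

/-- In particular the (X1)-type condition "`φ` is killed by `𝔭₋`" may be checked on any family of tangent curves:
if for every `v` some curve tangent to `X_v` and some curve tangent to `X_{iv}` give
`∂_t φ(g·γ₁(t))|₀ + i ∂_t φ(g·γ₂(t))|₀ = 0` for all `g`, then every `X ∈ ballFD.Pminus` kills `φ`. -/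
theorem killed_of_curves {φ : U21 → (Fin 2 → ℂ)} (hφ : φ ∈ ballFD.Cochain)
    (γ : (Fin 2 → ℂ) → ℝ → U21) (hγ : ∀ v, TangentCurve v (γ v))
    (h0 : ∀ v g, deriv (fun t : ℝ => φ (g * γ v t)) 0 + I • deriv (fun t : ℝ => φ (g * γ (I • v) t)) 0 = 0) :
    ∀ X ∈ ballFD.Pminus, X φ = 0 := by
  rintro X ⟨v, rfl⟩
  funext g
  rw [Xminus_apply_of_curves hφ (hγ v) (hγ (I • v)) g, h0 v g]
  rfl

end BallCR
end PerL34
end HodgeCM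

end

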